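/-
Copyright: statement-level skeleton of a published paper (lit-balaban cell, Phase-2 proof seat p13, gen 11). No proof
claims beyond what the kernel checks below.
-/
import Literature.MathematicalPhysics.QuantumFieldTheory.BalabanImbrieJaffe1984to88.BIJ88TraceTermsBound579

/-!
# `BalabanImbrieJaffe1984to88.BIJ88W2Localized292` — T. Bałaban, J. Imbrie, A. Jaffe, *Effective action and cluster
properties of the abelian Higgs model*, Commun. Math. Phys. **114** (1988) 257–315 [BalabanImbrieJaffe1988]: Sect. 5.7,
p. 292 — THE MECHANISM OF THE `W^{(j)″}` BOUND: the free summation of a trace term LOCALIZED by a field, giving the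
VOLUME FACTOR `|X′ ∩ Λ₅^{(j)′} ∩ Λ₆^{(j+1)c}|` in place of the `(r(e_k)L^{k−j})^d|X|` of (5.7.9).

## The print (p. 292 [PDF 36], verbatim)

*"The term m = j is special; we bound that term directly without resummation. The random walk expansion is inserted for
C^{(j)}_{Λ₁₀^{(j)}}(u_{k+1}), and we obtain an expansion Σ_X W^{(j)″}(X), with
  |W^{(j)″}(X)| ≦ e_j^{1−α} e^{−cr(e_k)|X|} |X′ ∩ Λ₅^{(j)′} ∩ Λ₆^{(j+1)c}|.
Each term contributing to W^{(j)″}(X) must contain at least one kernel w₅. There is a summation in Λ₁₀^{(j)}, but since at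
least one field Ã_j is present, there is an exponential decay on the j-th scale localizing summations near Λ₅^{(j)′} ∩
Λ₆^{(j+1)c}. This gives rise to the volume factor in the above bound."*  (The sequel, *"The volume divergence will be beaten
by small factors coming from large fields …"*, is `BIJ88VolumeBeaten292`.)  Compare (5.7.9) p. 291: *"(r(e_k)L^{k−j})^d |X|
… This is to account for one free summation on T₁^{(j)}; all but one such summation is controlled by exponential decay on
the j-th scale"* — there the free summation runs over ALL sites of `X`; here it is confined to the region of the field.

statement-level skeleton of published theorems with citation tags; proofs where landed; nothing here is a claim about the Yang–Mills mass gap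

PDF held: `paper:balaban1988-cmp114-bij-abelian-higgs-effective-action` (journal page = PDF page + 256); pp. 291–292
[PDF 35–36] read as IMAGES (CCITT renders; copies `HOME/lit-balaban-p13/pages/original-p035-x2.png`, `-p036-x2.png`).

CITATION HEADER (lean-in-tree rule).  Part of the lit-balaban TYPED SKELETON (HOME `run/shared/lean/pub/lit-balaban/`):
WHAT IS REPRODUCED = row **C2.Eq5.7.10-5.7.12** of `HOME/lit-balaban-r16/ROWS-C2-part2.md` (E-row, pp. 291–294), member
*p. 292, the `W^{(j)″}(X)` bound and its printed mechanism*.  Unit `lit-balaban-p13` (gen 11), owner r16, referee ref-5.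
Built BY NAME on the gen-8 word/letter model of the (5.7.4) trace terms — `BIJ88TraceTerms579` (`letter`, `hull`,
`mem_hull_iff`, `psupp_subset_hull`, `card_hull_le`, `LinkedFrom`, `linkedFrom_of_bprod_apply_ne_zero`, `wlen`, `Wprime`,
`cubePolymers`), `BIJ88TraceTermsBound579` (`norm_bprod_le`, `sum_linkedFrom_le`), r01's `B4RandomWalk213.bprod`/
`sum_tuple_succ`, Mathlib's `finRotate`/`Fin.snoc_eq_cons_rotate`/`Matrix.trace_mul_comm`/`Matrix.linfty_opNorm_def`;
nothing restated.

## The typing (model instance, READING declared — the gen-8 model plus a MARKING)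

As in `BIJ88TraceTerms579`: sites `T`, cubes `ι` with `cube : T → ι`, letter families `C_a` (`a ∈ A`), `W_b` (`b ∈ B`) with
cube supports `sC`, `sW`; words `w : Fin l → A × B` with terms `tr(C_{a₁}W_{b₁}⋯C_{a_l}W_{b_l})`, regrouped by hull into
`wlen l S X`, `W(X) = Σ_{l≥1}(1/2l)·wlen l S_l X` (`Wprime S X`).  NEW here: a predicate `mk` of MARKED `W`-letters — the
pieces *"contain[ing] at least one kernel w₅"*, i.e. carrying a field `Ã_j` — and the finite set `Rs ⊂ T` of the sites of the
region (print: `Λ₅^{(j)′} ∩ Λ₆^{(j+1)c}`, where `Ã_j` is supported), with the ROW CONFINEMENT `W_b(z,y) ≠ 0 ⇒ z ∈ Rs` for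
marked `b` (the field multiplies at the site `z`); the W″-selection keeps only words with a marked letter
(`hS : S w → ∃ i, mk (w i).2`).  THE VOLUME FACTOR is `vol cube Rs X = |{z ∈ Rs : cube z ∈ X}|`, the number of region sites in
the cubes of `X` (print: `|X′ ∩ Λ₅^{(j)′} ∩ Λ₆^{(j+1)c}|`, `X′ ⊂ B_{k−j−1}(X)` by (5.7.14)).

## What is kernel-checked here

* §1 CYCLIC SURGERY (PRIVATE folklore helpers): `bprod_snoc` (peel the last factor), `comp_finRotate_eq_snoc`/`comp_finRotate_apply_lt` (the
  rotated word `w ∘ finRotate`), **`trace_bprod_comp_finRotate`** (the trace of a word is invariant under rotation),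
  `hull_comp_perm`, `prod_comp_perm`, `sum_comp_perm_eq` (hull, weights and the sum over words are permutation invariant).
* §2 **`abs_trace_mul_le_card`** — THE LOCALIZED FREE SUMMATION: a kernel `W` with non-zero rows confined to `S` has
  `|tr(W·M)| ≤ |S|·‖W‖·‖M‖` (`ℓ^∞`-operator norms): one summation over `S`, the rest paid by the norms.
* §3 **`abs_trace_bprod_le_of_confined`** — a word whose `W`-letter at position `i` is confined to `S` has
  `|tr(C_{a₀}W_{b₀}⋯C_{a_n}W_{b_n})| ≤ |S|·Π_m ‖C_{a_m}‖‖W_{b_m}‖` (rotate the confined letter to the front by cyclicity, §2,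
  submultiplicativity).
* §4 **`sum_anchored_le`** — THE ANCHORED SUM with exactly ONE volume factor: the words with hull `X`, first `W`-letter marked,
  first `C`-letter meeting it, tail linked from it, weighted by `vol(sW b₀)·Π u(a)v(b)`, total at most
  `|X ∩ R|·e^{−κ|X|}·N_M·N_C·(N_C N_W)^n` (`N_C`, `N_W` the `κ`-weighted rooted sums of gen 8, `N_M ≥ Σ_{b marked ∋ c}
  v(b)e^{κ|sW b|}|sW b|²` the marked rooted sum); helpers `vol_eq_sum`, `vol_mono`, `sum_linkedFrom_set_le`,
  `sum_meet_le_card_mul`, `prod_le_exp_mul_prod_of_hull`, `sum_vol_mul_le` (the exchange `Σ_b vol(sW b)g(b) ≤ |X ∩ R|·N_M`).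
* §5 **`abs_wlen_le_localized`** — for every selection forcing a marked letter, every cube set `X`, every `κ ≥ 0`:
  `|wlen (n+1) S X| ≤ (n+1)·|X ∩ R|·e^{−κ|X|}·N_M·N_C·(N_C N_W)^n` (charge each word to a marked position, rotate it to the
  front — trace, hull, weights unchanged — and sum anchored; `anchored_of_trace_ne_zero`).
* §6 **`abs_Wprime_le_localized`** (the length series converges for `N_C N_W < 1`, `|W″(X)| ≤ (N_M N_C/(2(1−N_C N_W)))·|X ∩ R|·
  e^{−κ|X|}`, the `1/2l` cancelling the `l`) and **`abs_Wprime_le_printed_localized`** — THE PRINTED SHAPE `|W″(X)| ≤ e_j^{1−α}·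
  e^{−cr(e_k)|X|}·|X ∩ R|` on the cube polymer system, `κ = c·r(e_k)`, under the constants hypothesis `N_M N_C/(2(1−N_C N_W)) ≤
  e_j^{1−α}` (the print's `e_j^{1−α}` = ONE marked kernel per term, the pieces carrying `w₅A′` being *"small (O(e_j^{1−α}))"*,
  p. 287; generic-constant reading as G-C2-p36-03) — the (S2) shape consumed by p36's knitting `BIJ88Ineq5714Proof.ineq5714_knit`.

HONEST SCOPE.  Letters, supports, the marking, the region and the rooted sums are INPUTS in the displayed shapes (nothing of
Sects. 2–5 is constructed; which pieces of the expansion carry `w₅` and the identification of `Rs` with the sites of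
`Λ₅^{(j)′} ∩ Λ₆^{(j+1)c}` are the instance's); the localization is obtained by cyclicity of the trace and operator-norm bounds —
the kernels' *"exponential decay on the j-th scale"* enters only through the norms and rooted sums, as in gen 8's (5.7.9);
the region geometry `X′ ⊂ B_{k−j−1}(X)` of (5.7.14) is not modelled (the factor here counts region sites in the cubes of `X`
itself).  One definition with body (`vol`) + theorems (eleven private folklore helpers); no `Prop` facts; axioms standard.
-/

namespace Literature.MathematicalPhysics.QuantumFieldTheory.BalabanImbrieJaffe1984to88.BIJ88W2Localized292

open Finset
open Literature.MathematicalPhysics.QuantumFieldTheory.Balaban1983to89.B4RandomWalk213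
  (bprod bprod_zero bprod_succ bprod_cons bprod_one sum_tuple_succ)
open BIJ88TraceTerms579 BIJ88TraceTermsBound579
open scoped Matrix Matrix.Norms.Operator

/-! ## §1 Cyclic surgery on words: the last factor, rotation, invariance of trace, hull and weights -/

section Surgery

variable {R : Type*} [Ring R] {κι : Type*}

/-- peel off the LAST factor of an ordered product: `b(y₀)⋯b(y_{n−1})·b(y) = bprod (snoc ys y)`. [folklore] -/
private theorem bprod_snoc (b : κι → R) : ∀ (n : ℕ) (ys : Fin n → κι) (y : κι),
    bprod b (n + 1) (Fin.snoc ys y) = bprod b n ys * b y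
  | 0, ys, y => by
      rw [bprod_one, bprod_zero, one_mul]
      rfl
  | n + 1, ys, y => by
      have h : (Fin.snoc ys y : Fin (n + 2) → κι) = Fin.cons (ys 0) (Fin.snoc (Fin.tail ys) y) := by
        rw [Fin.cons_snoc_eq_snoc_cons, Fin.cons_self_tail]
      rw [h, bprod_cons, bprod_snoc b n (Fin.tail ys) y, ← mul_assoc, ← bprod_succ]

/-- the ROTATED word `w ∘ finRotate`: `(w₁, …, w_n, w₀)`. [folklore] -/
private theorem comp_finRotate_eq_snoc {α : Type*} (n : ℕ) (w : Fin (n + 1) → α) :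
    (w ∘ finRotate (n + 1)) = Fin.snoc (Fin.tail w) (w 0) := by
  rw [Fin.snoc_eq_cons_rotate, Fin.cons_self_tail]
  rfl

/-- the rotated word at a non-terminal position: `(w ∘ finRotate) i = w (i+1)` for `i < n`. [folklore] -/
private theorem comp_finRotate_apply_lt {α : Type*} {n : ℕ} (w : Fin (n + 1) → α) {i : ℕ} (hi : i < n) :
    (w ∘ finRotate (n + 1)) ⟨i, hi.trans n.lt_succ_self⟩ = w ⟨i + 1, Nat.succ_lt_succ hi⟩ := by
  simp only [Function.comp_apply]
  rw [finRotate_of_lt hi]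

end Surgery

section Invariance

variable {T ι A B : Type*} [Fintype T] [DecidableEq T] [DecidableEq ι]

/-- **CYCLICITY**: the trace of a word is invariant under rotation of the word, `tr(L₀L₁⋯L_n) = tr(L₁⋯L_nL₀)`.
[folklore] -/
private theorem trace_bprod_comp_finRotate (L : A × B → Matrix T T ℝ) (n : ℕ) (w : Fin (n + 1) → A × B) :
    (bprod L (n + 1) (w ∘ finRotate (n + 1))).trace = (bprod L (n + 1) w).trace := by
  rw [comp_finRotate_eq_snoc, bprod_snoc, Matrix.trace_mul_comm, ← bprod_succ]

omit [Fintype T] [DecidableEq T] in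
/-- the hull of a word (the union of the supports of its letters) is invariant under any permutation of the positions.
[folklore] -/
private theorem hull_comp_perm (sC : A → Finset ι) (sW : B → Finset ι) (l : ℕ) (w : Fin l → A × B) (σ : Equiv.Perm (Fin l)) :
    hull sC sW l (w ∘ σ) = hull sC sW l w := by
  ext c
  rw [mem_hull_iff, mem_hull_iff]
  constructor
  · rintro ⟨i, hi⟩; exact ⟨σ i, hi⟩
  · rintro ⟨i, hi⟩; exact ⟨σ.symm i, by simpa using hi⟩

omit [Fintype T] [DecidableEq T] [DecidableEq ι] in
/-- a product of letter weights is invariant under any permutation of the positions. [folklore] -/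
private theorem prod_comp_perm (f : A × B → ℝ) (l : ℕ) (w : Fin l → A × B) (σ : Equiv.Perm (Fin l)) :
    ∏ i, f ((w ∘ σ) i) = ∏ i, f (w i) :=
  Equiv.prod_comp σ (fun i => f (w i))

omit [Fintype T] [DecidableEq T] [DecidableEq ι] in
/-- summing over all words is invariant under re-indexing the positions by a permutation. [folklore] -/
private theorem sum_comp_perm_eq [Fintype A] [Fintype B] [DecidableEq A] [DecidableEq B] (l : ℕ) (σ : Equiv.Perm (Fin l))
    (G : (Fin l → A × B) → ℝ) : ∑ w : Fin l → A × B, G (w ∘ σ) = ∑ w : Fin l → A × B, G w :=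
  Equiv.sum_comp (Equiv.arrowCongr σ.symm (Equiv.refl (A × B))) G

end Invariance

/-! ## §2 A free summation localized by a letter with confined rows -/

section Rows

variable {T : Type*} [Fintype T] [DecidableEq T]

/-- a row sum of a real kernel is at most its `ℓ^∞`-operator norm (max row sum). [folklore] -/
private theorem row_sum_abs_le_norm (M : Matrix T T ℝ) (i : T) : ∑ j, |M i j| ≤ ‖M‖ := by
  rw [Matrix.linfty_opNorm_def]
  have h2 : (∑ j, ‖M i j‖₊ : NNReal) ≤ Finset.univ.sup fun i' => ∑ j, ‖M i' j‖₊ :=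
    Finset.le_sup (f := fun i' => ∑ j, ‖M i' j‖₊) (Finset.mem_univ i)
  have h := NNReal.coe_le_coe.mpr h2
  rw [NNReal.coe_sum] at h
  simpa only [coe_nnnorm, Real.norm_eq_abs] using h

/-- an entry of a real kernel is at most its `ℓ^∞`-operator norm. [folklore] -/
private theorem abs_apply_le_norm (M : Matrix T T ℝ) (i j : T) : |M i j| ≤ ‖M‖ :=
  le_trans (Finset.single_le_sum (f := fun j' => |M i j'|) (fun _ _ => abs_nonneg _) (Finset.mem_univ j))
    (row_sum_abs_le_norm M i)

/-- **THE LOCALIZED FREE SUMMATION**: if the kernel `W` has its non-zero ROWS confined to a set of sites `S` (print: the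
letter carries a field `Ã_j` supported in `Λ₅^{(j)′} ∩ Λ₆^{(j+1)c}`), then for every kernel `M`,
`|tr(W·M)| ≤ |S|·‖W‖·‖M‖` — the trace's site summation costs the number of sites of `S` only, the remaining summation
being *"controlled by exponential decay"* (the operator norms). [cite: BalabanImbrieJaffe1988, p.292] -/
theorem abs_trace_mul_le_card (W M : Matrix T T ℝ) (S : Finset T) (hW : ∀ z y, W z y ≠ 0 → z ∈ S) :
    |(W * M).trace| ≤ S.card * ‖W‖ * ‖M‖ := by
  rw [Matrix.trace]
  simp only [Matrix.diag, Matrix.mul_apply]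
  calc |∑ z, ∑ y, W z y * M y z| ≤ ∑ z, |∑ y, W z y * M y z| := Finset.abs_sum_le_sum_abs _ _
    _ ≤ ∑ z, (if z ∈ S then ‖W‖ * ‖M‖ else 0) := by
        refine Finset.sum_le_sum fun z _ => ?_
        by_cases hz : z ∈ S
        · rw [if_pos hz]
          calc |∑ y, W z y * M y z| ≤ ∑ y, |W z y * M y z| := Finset.abs_sum_le_sum_abs _ _
            _ ≤ ∑ y, |W z y| * ‖M‖ := Finset.sum_le_sum fun y _ => by
                rw [abs_mul]; exact mul_le_mul_of_nonneg_left (abs_apply_le_norm M y z) (abs_nonneg _)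
            _ = (∑ y, |W z y|) * ‖M‖ := (Finset.sum_mul _ _ _).symm
            _ ≤ ‖W‖ * ‖M‖ := mul_le_mul_of_nonneg_right (row_sum_abs_le_norm W z) (norm_nonneg _)
        · rw [if_neg hz]
          have h0 : ∀ y, W z y * M y z = 0 := fun y => by
            by_cases hWz : W z y = 0
            · rw [hWz, zero_mul]
            · exact absurd (hW z y hWz) hz
          rw [Finset.sum_congr rfl fun y _ => h0 y, Finset.sum_const_zero, abs_zero]
    _ = S.card * ‖W‖ * ‖M‖ := by
        rw [← Finset.sum_filter, Finset.filter_mem_eq_inter, Finset.univ_inter, Finset.sum_const, nsmul_eq_mul]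
        ring

end Rows

/-! ## §3 The trace of a word containing a confined letter -/

section Word

variable {T ι A B : Type*} [Fintype T] [DecidableEq T] [DecidableEq ι]
variable {cube : T → ι} {Cl : A → Matrix T T ℝ} {sC : A → Finset ι} {Wl : B → Matrix T T ℝ} {sW : B → Finset ι}

/-- **A WORD WITH A CONFINED LETTER** — *"Each term contributing to W^{(j)″}(X) must contain at least one kernel w₅ … since
at least one field Ã_j is present, there is an exponential decay on the j-th scale localizing summations near Λ₅^{(j)′} ∩
Λ₆^{(j+1)c}"*: if the `W`-letter at position `i` of the word `w = ((a₀,b₀),…,(a_n,b_n))` has its non-zero rows confined to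
the sites `S`, then `|tr(C_{a₀}W_{b₀}⋯C_{a_n}W_{b_n})| ≤ |S|·Π_m ‖C_{a_m}‖‖W_{b_m}‖` — by cyclicity the confined letter is
rotated to the front, its row index is the only free summation, all others are paid by the operator norms.
[cite: BalabanImbrieJaffe1988, p.292] -/
theorem abs_trace_bprod_le_of_confined (S : Finset T) :
    ∀ (i n : ℕ) (hin : i ≤ n) (w : Fin (n + 1) → A × B),
      (∀ z y, Wl (w ⟨i, Nat.lt_succ_of_le hin⟩).2 z y ≠ 0 → z ∈ S) →
      |(bprod (letter Cl Wl) (n + 1) w).trace| ≤ S.card * ∏ m, (‖Cl (w m).1‖ * ‖Wl (w m).2‖)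
  | 0, 0, _, w, hW => by
      rw [bprod_one, letter, Matrix.trace_mul_comm, Fin.prod_univ_one]
      calc |(Wl (w 0).2 * Cl (w 0).1).trace| ≤ S.card * ‖Wl (w 0).2‖ * ‖Cl (w 0).1‖ :=
            abs_trace_mul_le_card _ _ S hW
        _ = S.card * (‖Cl (w 0).1‖ * ‖Wl (w 0).2‖) := by ring
  | 0, n + 1, _, w, hW => by
      -- tr(C W R) = tr(W (R C)), R = the rest of the word
      rw [bprod_succ, letter, mul_assoc, Matrix.trace_mul_comm, mul_assoc, Fin.prod_univ_succ]
      have hR := norm_bprod_le (Cl := Cl) (Wl := Wl) n (Fin.tail w)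
      calc |(Wl (w 0).2 * (bprod (letter Cl Wl) (n + 1) (Fin.tail w) * Cl (w 0).1)).trace|
          ≤ S.card * ‖Wl (w 0).2‖ * ‖bprod (letter Cl Wl) (n + 1) (Fin.tail w) * Cl (w 0).1‖ :=
            abs_trace_mul_le_card _ _ S hW
        _ ≤ S.card * ‖Wl (w 0).2‖ * ((∏ m : Fin (n + 1), (‖Cl (Fin.tail w m).1‖ * ‖Wl (Fin.tail w m).2‖)) *
              ‖Cl (w 0).1‖) :=
            mul_le_mul_of_nonneg_left ((Matrix.linfty_opNorm_mul _ _).trans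
              (mul_le_mul_of_nonneg_right hR (norm_nonneg _))) (mul_nonneg (Nat.cast_nonneg _) (norm_nonneg _))
        _ = S.card * (‖Cl (w 0).1‖ * ‖Wl (w 0).2‖ * ∏ m : Fin (n + 1), (‖Cl (w m.succ).1‖ * ‖Wl (w m.succ).2‖)) := by
            simp only [Fin.tail]; ring
  | i + 1, 0, hin, w, hW => absurd hin (Nat.not_succ_le_zero i)
  | i + 1, n + 1, hin, w, hW => by
      -- rotate the word by one: the confined letter moves to position i
      have hi : i < n + 1 := Nat.lt_of_succ_le hin
      have hrot := abs_trace_bprod_le_of_confined S i (n + 1) (Nat.le_of_succ_le hin) (w ∘ finRotate (n + 2)) (by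
        rw [comp_finRotate_apply_lt w hi]; exact hW)
      rw [trace_bprod_comp_finRotate, prod_comp_perm (fun p : A × B => ‖Cl p.1‖ * ‖Wl p.2‖)] at hrot
      exact hrot

end Word

/-! ## §4 The sum over words anchored at a confined letter: ONE volume factor `|X ∩ R|` -/

section Anchored

variable {T ι A B : Type*} [Fintype T] [DecidableEq T] [Fintype ι] [DecidableEq ι]
  [Fintype A] [DecidableEq A] [Fintype B] [DecidableEq B]
variable {cube : T → ι} {sC : A → Finset ι} {sW : B → Finset ι}

/-- THE VOLUME FACTOR: the number of sites of the region `Rs` (print: `Λ₅^{(j)′} ∩ Λ₆^{(j+1)c}`, by its sites) lying in the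
cubes of `Y` — `|Y ∩ Λ₅^{(j)′} ∩ Λ₆^{(j+1)c}|` measured in sites. [cite: BalabanImbrieJaffe1988, p.292] -/
def vol (cube : T → ι) (Rs : Finset T) (Y : Finset ι) : ℕ := (Rs.filter fun z => cube z ∈ Y).card

omit [Fintype T] [DecidableEq T] [Fintype ι] in
/-- the volume factor is monotone in the cube set. [cite: BalabanImbrieJaffe1988, p.292] -/
theorem vol_mono (cube : T → ι) (Rs : Finset T) {Y Z : Finset ι} (h : Y ⊆ Z) : vol cube Rs Y ≤ vol cube Rs Z :=
  Finset.card_le_card fun z hz => by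
    rw [Finset.mem_filter] at hz ⊢
    exact ⟨hz.1, h hz.2⟩

omit [Fintype T] [DecidableEq T] [Fintype ι] in
/-- the volume factor as a sum of indicators over the sites of the region. [cite: BalabanImbrieJaffe1988, p.292] -/
theorem vol_eq_sum (cube : T → ι) (Rs : Finset T) (Y : Finset ι) :
    (vol cube Rs Y : ℝ) = ∑ z ∈ Rs, (if cube z ∈ Y then (1 : ℝ) else 0) := by
  rw [vol, Finset.card_filter]
  push_cast
  rfl

omit [Fintype ι] [Fintype A] [DecidableEq A] [Fintype B] [DecidableEq B] in
/-- a word linked from a non-empty cube set is linked from one of its cubes (indicator of a union ≤ sum of indicators).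
[folklore] -/
private theorem ite_linkedFrom_le_sum_of_nonempty {Z : Finset ι} (hZ : Z.Nonempty) {v : ℝ} (hv : 0 ≤ v) :
    ∀ (l : ℕ) (w : Fin l → A × B),
      (if LinkedFrom sC sW Z l w then v else 0) ≤ ∑ c ∈ Z, (if LinkedFrom sC sW {c} l w then v else 0)
  | 0, w => by
      simp only [LinkedFrom, if_true, Finset.sum_const, nsmul_eq_mul]
      have : (1 : ℝ) ≤ Z.card := by exact_mod_cast Finset.card_pos.2 hZ
      nlinarith
  | l + 1, w => by
      by_cases h : LinkedFrom sC sW Z (l + 1) w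
      · rw [if_pos h]
        obtain ⟨⟨c, hc⟩, h2, h3⟩ := h
        rw [Finset.mem_inter] at hc
        have hc' : LinkedFrom sC sW {c} (l + 1) w :=
          ⟨⟨c, Finset.mem_inter.2 ⟨Finset.mem_singleton_self c, hc.2⟩⟩, h2, h3⟩
        calc v = (if LinkedFrom sC sW {c} (l + 1) w then v else 0) := by rw [if_pos hc']
          _ ≤ ∑ c ∈ Z, (if LinkedFrom sC sW {c} (l + 1) w then v else 0) :=
              Finset.single_le_sum (f := fun c => if LinkedFrom sC sW {c} (l + 1) w then v else 0)
                (fun c _ => ite_nonneg hv le_rfl) hc.1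
      · rw [if_neg h]
        exact Finset.sum_nonneg fun c _ => ite_nonneg hv le_rfl

omit [Fintype ι] [DecidableEq A] [DecidableEq B] in
/-- the words linked from a non-empty cube set `Z`: their weighted number is at most `|Z|·(N_C N_W)^l` (gen 8's rooted
linked-chain sum `sum_linkedFrom_le` at each cube of `Z`). [cite: BalabanImbrieJaffe1988, (5.7.9) p.291, p.292] -/
theorem sum_linkedFrom_set_le {f : A → ℝ} {g : B → ℝ} (hf : ∀ a, 0 ≤ f a) (hg : ∀ b, 0 ≤ g b) {NC NW : ℝ}
    (hNC : ∀ c : ι, ∑ a, (if c ∈ sC a then f a * (sC a).card else 0) ≤ NC)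
    (hNW : ∀ c : ι, ∑ b, (if c ∈ sW b then g b * (sW b).card else 0) ≤ NW)
    (l : ℕ) {Z : Finset ι} (hZ : Z.Nonempty) :
    ∑ w : Fin l → A × B, (if LinkedFrom sC sW Z l w then ∏ i, (f (w i).1 * g (w i).2) else 0)
      ≤ Z.card * (NC * NW) ^ l := by
  calc ∑ w : Fin l → A × B, (if LinkedFrom sC sW Z l w then ∏ i, (f (w i).1 * g (w i).2) else 0)
      ≤ ∑ w : Fin l → A × B, ∑ c ∈ Z, (if LinkedFrom sC sW {c} l w then ∏ i, (f (w i).1 * g (w i).2) else 0) :=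
        Finset.sum_le_sum fun w _ => ite_linkedFrom_le_sum_of_nonempty hZ
          (Finset.prod_nonneg fun i _ => mul_nonneg (hf _) (hg _)) l w
    _ = ∑ c ∈ Z, ∑ w : Fin l → A × B, (if LinkedFrom sC sW {c} l w then ∏ i, (f (w i).1 * g (w i).2) else 0) :=
        Finset.sum_comm
    _ ≤ ∑ c ∈ Z, (NC * NW) ^ l := Finset.sum_le_sum fun c _ => sum_linkedFrom_le hf hg hNC hNW l c
    _ = Z.card * (NC * NW) ^ l := by rw [Finset.sum_const, nsmul_eq_mul]

omit [Fintype ι] [DecidableEq A] [Fintype B] [DecidableEq B] in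
/-- the letters MEETING a cube set `Y` weigh at most `|Y|·N_C` (each is summed through one of the cubes of `Y`; the
rooted sum `Σ_{a : c ∈ sC a} u(a)|sC a| ≤ N_C` dominates `Σ_{a : c ∈ sC a} u(a)`). [folklore] -/
private theorem sum_meet_le_card_mul {u : A → ℝ} (hu : ∀ a, 0 ≤ u a) {NC : ℝ}
    (hNC : ∀ c : ι, ∑ a, (if c ∈ sC a then u a * (sC a).card else 0) ≤ NC) (Y : Finset ι) :
    ∑ a, (if (sC a ∩ Y).Nonempty then u a else 0) ≤ Y.card * NC := by
  calc ∑ a, (if (sC a ∩ Y).Nonempty then u a else 0)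
      ≤ ∑ a, ∑ d ∈ Y, (if d ∈ sC a then u a else 0) := by
        refine Finset.sum_le_sum fun a _ => ?_
        by_cases ha : (sC a ∩ Y).Nonempty
        · rw [if_pos ha]
          obtain ⟨d, hd⟩ := ha
          rw [Finset.mem_inter] at hd
          calc u a = (if d ∈ sC a then u a else 0) := by rw [if_pos hd.1]
            _ ≤ ∑ d ∈ Y, (if d ∈ sC a then u a else 0) :=
                Finset.single_le_sum (f := fun d => if d ∈ sC a then u a else 0)
                  (fun d _ => ite_nonneg (hu a) le_rfl) hd.2
        · rw [if_neg ha]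
          exact Finset.sum_nonneg fun d _ => ite_nonneg (hu a) le_rfl
    _ = ∑ d ∈ Y, ∑ a, (if d ∈ sC a then u a else 0) := Finset.sum_comm
    _ ≤ ∑ d ∈ Y, NC := by
        refine Finset.sum_le_sum fun d _ => le_trans (Finset.sum_le_sum fun a _ => ?_) (hNC d)
        by_cases hd : d ∈ sC a
        · rw [if_pos hd, if_pos hd]
          have h1 : (1 : ℝ) ≤ (sC a).card := by exact_mod_cast Finset.card_pos.2 ⟨d, hd⟩
          nlinarith [hu a]
        · rw [if_neg hd, if_neg hd]
    _ = Y.card * NC := by rw [Finset.sum_const, nsmul_eq_mul]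

omit [Fintype ι] [Fintype A] [DecidableEq A] [Fintype B] [DecidableEq B] in
/-- the decay in `|X|` from the `κ`-weights: for a word with hull `X`, `Π u(a_i)v(b_i) ≤ e^{−κ|X|}·Π (u(a_i)e^{κ|sC a_i|})
(v(b_i)e^{κ|sW b_i|})` (`|X| ≤ Σ_i (|sC a_i| + |sW b_i|)`, `card_hull_le`). [cite: BalabanImbrieJaffe1988, (5.7.9) p.291] -/
theorem prod_le_exp_mul_prod_of_hull {u : A → ℝ} {v : B → ℝ} (hu : ∀ a, 0 ≤ u a) (hv : ∀ b, 0 ≤ v b) {κ : ℝ}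
    (hκ : 0 ≤ κ) {l : ℕ} {w : Fin l → A × B} {X : Finset ι} (hX : hull sC sW l w = X) :
    ∏ i, (u (w i).1 * v (w i).2) ≤ Real.exp (-(κ * X.card)) *
      ∏ i, (u (w i).1 * Real.exp (κ * (sC (w i).1).card) * (v (w i).2 * Real.exp (κ * (sW (w i).2).card))) := by
  have hcard : (X.card : ℝ) ≤ ∑ i, (((sC (w i).1).card : ℝ) + (sW (w i).2).card) := by
    rw [← hX]; exact_mod_cast card_hull_le sC sW l w
  have hexp : Real.exp (κ * X.card) ≤ ∏ i, (Real.exp (κ * (sC (w i).1).card) * Real.exp (κ * (sW (w i).2).card)) := by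
    have hprod : ∏ i, (Real.exp (κ * (sC (w i).1).card) * Real.exp (κ * (sW (w i).2).card)) =
        Real.exp (∑ i, (κ * (sC (w i).1).card + κ * (sW (w i).2).card)) := by
      rw [Real.exp_sum]
      exact Finset.prod_congr rfl fun i _ => (Real.exp_add _ _).symm
    rw [hprod, Real.exp_le_exp]
    calc κ * X.card ≤ κ * ∑ i, (((sC (w i).1).card : ℝ) + (sW (w i).2).card) := mul_le_mul_of_nonneg_left hcard hκ
      _ = ∑ i, (κ * (sC (w i).1).card + κ * (sW (w i).2).card) := by
          rw [Finset.mul_sum]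
          exact Finset.sum_congr rfl fun i _ => by ring
  have hP0 : 0 ≤ ∏ i, (u (w i).1 * v (w i).2) := Finset.prod_nonneg fun i _ => mul_nonneg (hu _) (hv _)
  calc ∏ i, (u (w i).1 * v (w i).2)
      = (∏ i, (u (w i).1 * v (w i).2)) * (Real.exp (-(κ * X.card)) * Real.exp (κ * X.card)) := by
        rw [← Real.exp_add, neg_add_cancel, Real.exp_zero, mul_one]
    _ ≤ (∏ i, (u (w i).1 * v (w i).2)) * (Real.exp (-(κ * X.card)) *
          ∏ i, (Real.exp (κ * (sC (w i).1).card) * Real.exp (κ * (sW (w i).2).card))) :=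
        mul_le_mul_of_nonneg_left (mul_le_mul_of_nonneg_left hexp (Real.exp_nonneg _)) hP0
    _ = Real.exp (-(κ * X.card)) *
          ∏ i, (u (w i).1 * Real.exp (κ * (sC (w i).1).card) * (v (w i).2 * Real.exp (κ * (sW (w i).2).card))) := by
        rw [mul_left_comm, ← Finset.prod_mul_distrib]
        exact congrArg _ (Finset.prod_congr rfl fun i _ => by ring)

omit [Fintype T] [DecidableEq T] [Fintype ι] [DecidableEq A] [DecidableEq B] in
/-- **THE EXCHANGE behind the volume factor**: summing, over the MARKED letters supported inside `X`, the number of region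
sites in their support times a weight `g ≥ 0` gives at most `|X ∩ R|·N_M`, `N_M` the marked rooted sum of `g` — each
region site in `X` is counted through the marked letters whose support contains its cube. [cite: BalabanImbrieJaffe1988, p.292] -/
theorem sum_vol_mul_le (Rs : Finset T) (mk : B → Prop) [DecidablePred mk] {g : B → ℝ} (hg : ∀ b, 0 ≤ g b) {NM : ℝ}
    (hNM : ∀ c : ι, ∑ b, (if mk b ∧ c ∈ sW b then g b else 0) ≤ NM) (X : Finset ι) :
    ∑ b, (if mk b ∧ sW b ⊆ X then (vol cube Rs (sW b) : ℝ) * g b else 0) ≤ vol cube Rs X * NM := by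
  have hNM0 : ∀ c, 0 ≤ NM := fun c =>
    le_trans (Finset.sum_nonneg fun b _ => ite_nonneg (hg b) le_rfl) (hNM c)
  calc ∑ b, (if mk b ∧ sW b ⊆ X then (vol cube Rs (sW b) : ℝ) * g b else 0)
      = ∑ b, ∑ z ∈ Rs, (if mk b ∧ sW b ⊆ X ∧ cube z ∈ sW b then g b else 0) := by
        refine Finset.sum_congr rfl fun b _ => ?_
        by_cases hb : mk b ∧ sW b ⊆ X
        · rw [if_pos hb, vol_eq_sum, Finset.sum_mul]
          refine Finset.sum_congr rfl fun z _ => ?_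
          by_cases hz : cube z ∈ sW b
          · rw [if_pos hz, if_pos ⟨hb.1, hb.2, hz⟩, one_mul]
          · rw [if_neg hz, if_neg (fun h => hz h.2.2), zero_mul]
        · rw [if_neg hb]
          refine (Finset.sum_eq_zero fun z _ => ?_).symm
          rw [if_neg (fun h => hb ⟨h.1, h.2.1⟩)]
    _ = ∑ z ∈ Rs, ∑ b, (if mk b ∧ sW b ⊆ X ∧ cube z ∈ sW b then g b else 0) := Finset.sum_comm
    _ ≤ ∑ z ∈ Rs, (if cube z ∈ X then NM else 0) := by
        refine Finset.sum_le_sum fun z _ => ?_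
        by_cases hzX : cube z ∈ X
        · rw [if_pos hzX]
          refine le_trans (Finset.sum_le_sum fun b _ => ?_) (hNM (cube z))
          by_cases h : mk b ∧ sW b ⊆ X ∧ cube z ∈ sW b
          · rw [if_pos h, if_pos ⟨h.1, h.2.2⟩]
          · rw [if_neg h]; exact ite_nonneg (hg b) le_rfl
        · rw [if_neg hzX]
          refine (Finset.sum_eq_zero fun b _ => ?_).le
          rw [if_neg]
          rintro ⟨-, hsub, hz⟩
          exact hzX (hsub hz)
    _ = vol cube Rs X * NM := by
        rw [← Finset.sum_filter, Finset.sum_const, nsmul_eq_mul]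
        rfl

omit [Fintype T] [DecidableEq T] [Fintype ι] [DecidableEq A] [DecidableEq B] in
/-- **THE ANCHORED SUM** — the words of length `n+1` with hull `X` whose FIRST `W`-letter is marked, whose first `C`-letter
meets it and whose tail is linked from it (the shape forced by a non-zero trace, after rotating the marked letter to the
front), weighted by the volume factor of the marked support and the letter weights, sum to at most
`|X ∩ R|·e^{−κ|X|}·N_M·N_C·(N_C N_W)^n`: the marked letter is summed through a region site of `X` (`sum_vol_mul_le`), the
first `C`-letter through a cube of the marked support (`sum_meet_le_card_mul`), the tail as a rooted linked chain
(`sum_linkedFrom_set_le`) — the two extra factors `|sW b|` are the square in the marked rooted sum `N_M`.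
[cite: BalabanImbrieJaffe1988, p.292] -/
theorem sum_anchored_le (Rs : Finset T) (mk : B → Prop) [DecidablePred mk] {u : A → ℝ} {v : B → ℝ}
    (hu : ∀ a, 0 ≤ u a) (hv : ∀ b, 0 ≤ v b) {κ : ℝ} (hκ : 0 ≤ κ) {NC NW NM : ℝ} (hNC0 : 0 ≤ NC) (hNW0 : 0 ≤ NW)
    (hNC : ∀ c : ι, ∑ a, (if c ∈ sC a then u a * Real.exp (κ * (sC a).card) * (sC a).card else 0) ≤ NC)
    (hNW : ∀ c : ι, ∑ b, (if c ∈ sW b then v b * Real.exp (κ * (sW b).card) * (sW b).card else 0) ≤ NW)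
    (hNM : ∀ c : ι, ∑ b, (if mk b ∧ c ∈ sW b then v b * Real.exp (κ * (sW b).card) * (sW b).card ^ 2 else 0) ≤ NM)
    (n : ℕ) (X : Finset ι) :
    ∑ w : Fin (n + 1) → A × B,
      (if hull sC sW (n + 1) w = X ∧ mk (w 0).2 ∧ (sC (w 0).1 ∩ sW (w 0).2).Nonempty ∧
          LinkedFrom sC sW (sW (w 0).2) n (Fin.tail w)
        then (vol cube Rs (sW (w 0).2) : ℝ) * ∏ i, (u (w i).1 * v (w i).2) else 0)
      ≤ vol cube Rs X * (Real.exp (-(κ * X.card)) * (NM * NC * (NC * NW) ^ n)) := by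
  -- the κ-weighted letters
  set uu : A → ℝ := fun a => u a * Real.exp (κ * (sC a).card) with huu
  set vv : B → ℝ := fun b => v b * Real.exp (κ * (sW b).card) with hvv
  have huu0 : ∀ a, 0 ≤ uu a := fun a => mul_nonneg (hu a) (Real.exp_nonneg _)
  have hvv0 : ∀ b, 0 ≤ vv b := fun b => mul_nonneg (hv b) (Real.exp_nonneg _)
  have hθ0 : 0 ≤ (NC * NW) ^ n := pow_nonneg (mul_nonneg hNC0 hNW0) n
  -- Step A: pass to the κ-weights and weaken `hull = X` to `sW b₀ ⊆ X`
  have hA : ∀ w : Fin (n + 1) → A × B,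
      (if hull sC sW (n + 1) w = X ∧ mk (w 0).2 ∧ (sC (w 0).1 ∩ sW (w 0).2).Nonempty ∧
          LinkedFrom sC sW (sW (w 0).2) n (Fin.tail w)
        then (vol cube Rs (sW (w 0).2) : ℝ) * ∏ i, (u (w i).1 * v (w i).2) else 0) ≤
      Real.exp (-(κ * X.card)) *
        (if sW (w 0).2 ⊆ X ∧ mk (w 0).2 ∧ (sC (w 0).1 ∩ sW (w 0).2).Nonempty ∧
            LinkedFrom sC sW (sW (w 0).2) n (Fin.tail w)
          then (vol cube Rs (sW (w 0).2) : ℝ) * ∏ i, (uu (w i).1 * vv (w i).2) else 0) := by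
    intro w
    by_cases hP : hull sC sW (n + 1) w = X ∧ mk (w 0).2 ∧ (sC (w 0).1 ∩ sW (w 0).2).Nonempty ∧
        LinkedFrom sC sW (sW (w 0).2) n (Fin.tail w)
    · have hsub : sW (w 0).2 ⊆ X := by
        rw [← hP.1]
        exact (Finset.subset_union_right).trans (psupp_subset_hull sC sW (n + 1) w 0)
      rw [if_pos hP, if_pos ⟨hsub, hP.2⟩, mul_left_comm]
      exact mul_le_mul_of_nonneg_left (prod_le_exp_mul_prod_of_hull hu hv hκ hP.1) (Nat.cast_nonneg _)
    · rw [if_neg hP]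
      exact mul_nonneg (Real.exp_nonneg _) (ite_nonneg (mul_nonneg (Nat.cast_nonneg _)
        (Finset.prod_nonneg fun i _ => mul_nonneg (huu0 _) (hvv0 _))) le_rfl)
  -- Steps B and C on the κ-weighted sum
  have hmain : ∑ w : Fin (n + 1) → A × B,
      (if sW (w 0).2 ⊆ X ∧ mk (w 0).2 ∧ (sC (w 0).1 ∩ sW (w 0).2).Nonempty ∧
          LinkedFrom sC sW (sW (w 0).2) n (Fin.tail w)
        then (vol cube Rs (sW (w 0).2) : ℝ) * ∏ i, (uu (w i).1 * vv (w i).2) else 0) ≤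
      vol cube Rs X * (NM * NC * (NC * NW) ^ n) := by
   -- Step B: first pair / tail
   rw [sum_tuple_succ]
   simp only [Fin.cons_zero, Fin.tail_cons, Fin.prod_univ_succ, Fin.cons_succ]
   have hB : ∀ p : A × B,
      ∑ t : Fin n → A × B,
        (if sW p.2 ⊆ X ∧ mk p.2 ∧ (sC p.1 ∩ sW p.2).Nonempty ∧ LinkedFrom sC sW (sW p.2) n t
          then (vol cube Rs (sW p.2) : ℝ) * (uu p.1 * vv p.2 * ∏ i, (uu (t i).1 * vv (t i).2)) else 0) ≤
      (if (sC p.1 ∩ sW p.2).Nonempty then uu p.1 else 0) *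
        (if mk p.2 ∧ sW p.2 ⊆ X then (vol cube Rs (sW p.2) : ℝ) * (vv p.2 * (sW p.2).card) else 0) *
          (NC * NW) ^ n := by
    intro p
    by_cases hp : sW p.2 ⊆ X ∧ mk p.2 ∧ (sC p.1 ∩ sW p.2).Nonempty
    · have hZ : (sW p.2).Nonempty := let ⟨d, hd⟩ := hp.2.2; ⟨d, (Finset.mem_inter.1 hd).2⟩
      rw [if_pos hp.2.2, if_pos ⟨hp.2.1, hp.1⟩]
      calc ∑ t : Fin n → A × B,
            (if sW p.2 ⊆ X ∧ mk p.2 ∧ (sC p.1 ∩ sW p.2).Nonempty ∧ LinkedFrom sC sW (sW p.2) n t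
              then (vol cube Rs (sW p.2) : ℝ) * (uu p.1 * vv p.2 * ∏ i, (uu (t i).1 * vv (t i).2)) else 0)
          = (vol cube Rs (sW p.2) : ℝ) * (uu p.1 * vv p.2) * ∑ t : Fin n → A × B,
              (if LinkedFrom sC sW (sW p.2) n t then ∏ i, (uu (t i).1 * vv (t i).2) else 0) := by
            rw [Finset.mul_sum]
            refine Finset.sum_congr rfl fun t _ => ?_
            by_cases ht : LinkedFrom sC sW (sW p.2) n t
            · rw [if_pos ⟨hp.1, hp.2.1, hp.2.2, ht⟩, if_pos ht]; ring
            · rw [if_neg (fun h => ht h.2.2.2), if_neg ht, mul_zero]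
        _ ≤ (vol cube Rs (sW p.2) : ℝ) * (uu p.1 * vv p.2) * ((sW p.2).card * (NC * NW) ^ n) :=
            mul_le_mul_of_nonneg_left (sum_linkedFrom_set_le huu0 hvv0 hNC hNW n hZ)
              (mul_nonneg (Nat.cast_nonneg _) (mul_nonneg (huu0 _) (hvv0 _)))
        _ = uu p.1 * ((vol cube Rs (sW p.2) : ℝ) * (vv p.2 * (sW p.2).card)) * (NC * NW) ^ n := by ring
    · have hzero : ∀ t : Fin n → A × B,
          (if sW p.2 ⊆ X ∧ mk p.2 ∧ (sC p.1 ∩ sW p.2).Nonempty ∧ LinkedFrom sC sW (sW p.2) n t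
            then (vol cube Rs (sW p.2) : ℝ) * (uu p.1 * vv p.2 * ∏ i, (uu (t i).1 * vv (t i).2)) else 0) = 0 := by
        intro t
        rw [if_neg]
        exact fun h => hp ⟨h.1, h.2.1, h.2.2.1⟩
      rw [Finset.sum_congr rfl fun t _ => hzero t, Finset.sum_const_zero]
      exact mul_nonneg (mul_nonneg (ite_nonneg (huu0 _) le_rfl) (ite_nonneg (mul_nonneg (Nat.cast_nonneg _)
        (mul_nonneg (hvv0 _) (Nat.cast_nonneg _))) le_rfl)) hθ0
   refine (Finset.sum_le_sum fun p _ => hB p).trans ?_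
   -- sum over the first pair: `a` through a cube of `sW b`, then `b` through a region site of `X`
   rw [← Finset.sum_mul, Fintype.sum_prod_type, Finset.sum_comm]
   have hC : ∀ b : B, ∑ a : A, (if (sC a ∩ sW b).Nonempty then uu a else 0) *
      (if mk b ∧ sW b ⊆ X then (vol cube Rs (sW b) : ℝ) * (vv b * (sW b).card) else 0) ≤
      NC * (if mk b ∧ sW b ⊆ X then (vol cube Rs (sW b) : ℝ) * (vv b * (sW b).card ^ 2) else 0) := by
    intro b
    rw [← Finset.sum_mul]
    have hmeet : ∑ a : A, (if (sC a ∩ sW b).Nonempty then uu a else 0) ≤ (sW b).card * NC :=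
      sum_meet_le_card_mul huu0 (fun c => by simpa only [huu] using hNC c) (sW b)
    by_cases hb : mk b ∧ sW b ⊆ X
    · rw [if_pos hb, if_pos hb]
      calc (∑ a : A, (if (sC a ∩ sW b).Nonempty then uu a else 0)) * ((vol cube Rs (sW b) : ℝ) * (vv b * (sW b).card))
          ≤ ((sW b).card * NC) * ((vol cube Rs (sW b) : ℝ) * (vv b * (sW b).card)) :=
            mul_le_mul_of_nonneg_right hmeet (mul_nonneg (Nat.cast_nonneg _) (mul_nonneg (hvv0 _) (Nat.cast_nonneg _)))
        _ = NC * ((vol cube Rs (sW b) : ℝ) * (vv b * (sW b).card ^ 2)) := by ring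
    · rw [if_neg hb, if_neg hb, mul_zero, mul_zero]
   have hsum : ∑ b : B, ∑ a : A, (if (sC a ∩ sW b).Nonempty then uu a else 0) *
      (if mk b ∧ sW b ⊆ X then (vol cube Rs (sW b) : ℝ) * (vv b * (sW b).card) else 0) ≤
      NC * (vol cube Rs X * NM) := by
    calc ∑ b : B, ∑ a : A, (if (sC a ∩ sW b).Nonempty then uu a else 0) *
          (if mk b ∧ sW b ⊆ X then (vol cube Rs (sW b) : ℝ) * (vv b * (sW b).card) else 0)
        ≤ ∑ b : B, NC * (if mk b ∧ sW b ⊆ X then (vol cube Rs (sW b) : ℝ) * (vv b * (sW b).card ^ 2) else 0) :=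
          Finset.sum_le_sum fun b _ => hC b
      _ = NC * ∑ b : B, (if mk b ∧ sW b ⊆ X then (vol cube Rs (sW b) : ℝ) * (vv b * (sW b).card ^ 2) else 0) := by
          rw [Finset.mul_sum]
      _ ≤ NC * (vol cube Rs X * NM) := by
          refine mul_le_mul_of_nonneg_left ?_ hNC0
          refine sum_vol_mul_le Rs mk (fun b => mul_nonneg (hvv0 b) (pow_nonneg (Nat.cast_nonneg _) 2)) ?_ X
          intro c
          simpa only [hvv, mul_assoc] using hNM c
   calc (∑ b : B, ∑ a : A, (if (sC a ∩ sW b).Nonempty then uu a else 0) *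
         (if mk b ∧ sW b ⊆ X then (vol cube Rs (sW b) : ℝ) * (vv b * (sW b).card) else 0)) * (NC * NW) ^ n
       ≤ NC * (vol cube Rs X * NM) * (NC * NW) ^ n := mul_le_mul_of_nonneg_right hsum hθ0
     _ = vol cube Rs X * (NM * NC * (NC * NW) ^ n) := by ring
  calc ∑ w : Fin (n + 1) → A × B,
        (if hull sC sW (n + 1) w = X ∧ mk (w 0).2 ∧ (sC (w 0).1 ∩ sW (w 0).2).Nonempty ∧
            LinkedFrom sC sW (sW (w 0).2) n (Fin.tail w)
          then (vol cube Rs (sW (w 0).2) : ℝ) * ∏ i, (u (w i).1 * v (w i).2) else 0)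
      ≤ ∑ w : Fin (n + 1) → A × B, Real.exp (-(κ * X.card)) *
          (if sW (w 0).2 ⊆ X ∧ mk (w 0).2 ∧ (sC (w 0).1 ∩ sW (w 0).2).Nonempty ∧
              LinkedFrom sC sW (sW (w 0).2) n (Fin.tail w)
            then (vol cube Rs (sW (w 0).2) : ℝ) * ∏ i, (uu (w i).1 * vv (w i).2) else 0) :=
        Finset.sum_le_sum fun w _ => hA w
    _ ≤ Real.exp (-(κ * X.card)) * (vol cube Rs X * (NM * NC * (NC * NW) ^ n)) := by
        rw [← Finset.mul_sum]
        exact mul_le_mul_of_nonneg_left hmain (Real.exp_nonneg _)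
    _ = vol cube Rs X * (Real.exp (-(κ * X.card)) * (NM * NC * (NC * NW) ^ n)) := by ring

end Anchored

/-! ## §5 `|wlen l S X|` for selections forcing a confined letter: the volume factor `|X ∩ R|` -/

section Localized

variable {T ι A B : Type*} [Fintype T] [DecidableEq T] [Fintype ι] [DecidableEq ι]
  [Fintype A] [DecidableEq A] [Fintype B] [DecidableEq B]
variable {cube : T → ι} {Cl : A → Matrix T T ℝ} {sC : A → Finset ι} {Wl : B → Matrix T T ℝ} {sW : B → Finset ι}

omit [Fintype ι] [Fintype A] [DecidableEq A] [Fintype B] [DecidableEq B] in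
/-- a non-zero trace has a non-zero diagonal entry, which roots the word: its first `C`-letter meets its first `W`-letter and
its tail is linked from the first `W`-support (gen 8's `linkedFrom_of_bprod_apply_ne_zero`, first link dropped).
[cite: BalabanImbrieJaffe1988, (5.7.9) p.291] -/
theorem anchored_of_trace_ne_zero
    (hCs : ∀ a x y, Cl a x y ≠ 0 → cube x ∈ sC a ∧ cube y ∈ sC a)
    (hWs : ∀ b x y, Wl b x y ≠ 0 → cube x ∈ sW b ∧ cube y ∈ sW b)
    (n : ℕ) (w : Fin (n + 1) → A × B) (h : (bprod (letter Cl Wl) (n + 1) w).trace ≠ 0) :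
    (sC (w 0).1 ∩ sW (w 0).2).Nonempty ∧ LinkedFrom sC sW (sW (w 0).2) n (Fin.tail w) := by
  obtain ⟨x, -, hx⟩ := Finset.exists_ne_zero_of_sum_ne_zero h
  obtain ⟨-, h2, h3⟩ := linkedFrom_of_bprod_apply_ne_zero hCs hWs (n + 1) w hx
  exact ⟨h2, h3⟩

omit [Fintype ι] [DecidableEq A] [DecidableEq B] in
/-- **`|wlen l S X|` WITH THE LOCALIZED VOLUME FACTOR** — *"This gives rise to the volume factor in the above bound"*: if every
selected word contains a MARKED `W`-letter (print: *"at least one kernel w₅"*, carrying a field `Ã_j`), marked letters have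
their non-zero rows confined to the sites `Rs` of the region (print: `Λ₅^{(j)′} ∩ Λ₆^{(j+1)c}`), and the letter families have
`κ`-weighted rooted sums `N_C`, `N_W` (as in gen 8's `abs_wlen_le`) and the MARKED rooted sum
`N_M ≥ Σ_{b marked, c ∈ sW b} ‖W_b‖e^{κ|sW b|}|sW b|²`, then for every cube set `X`:
`|wlen (n+1) S X| ≤ (n+1)·|X ∩ R|·e^{−κ|X|}·N_M·N_C·(N_C N_W)^n`, `|X ∩ R| = vol` the number of region sites in the cubes of
`X` — in place of the `s·|X|` (ALL sites of `X`) of (5.7.9).  Mechanism: each word is charged to one of its marked positions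
(the factor `n+1`), rotated so that the marked letter comes first (cyclicity of the trace, `abs_trace_bprod_le_of_confined`),
and the rotated words are summed anchored at the marked letter (`sum_anchored_le`). [cite: BalabanImbrieJaffe1988, p.292] -/
theorem abs_wlen_le_localized
    (hCs : ∀ a x y, Cl a x y ≠ 0 → cube x ∈ sC a ∧ cube y ∈ sC a)
    (hWs : ∀ b x y, Wl b x y ≠ 0 → cube x ∈ sW b ∧ cube y ∈ sW b)
    (Rs : Finset T) (mk : B → Prop) [DecidablePred mk] (hmk : ∀ b, mk b → ∀ z y, Wl b z y ≠ 0 → z ∈ Rs)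
    {κ : ℝ} (hκ : 0 ≤ κ) {NC NW NM : ℝ} (hNC0 : 0 ≤ NC) (hNW0 : 0 ≤ NW)
    (hNC : ∀ c : ι, ∑ a, (if c ∈ sC a then ‖Cl a‖ * Real.exp (κ * (sC a).card) * (sC a).card else 0) ≤ NC)
    (hNW : ∀ c : ι, ∑ b, (if c ∈ sW b then ‖Wl b‖ * Real.exp (κ * (sW b).card) * (sW b).card else 0) ≤ NW)
    (hNM : ∀ c : ι, ∑ b, (if mk b ∧ c ∈ sW b then ‖Wl b‖ * Real.exp (κ * (sW b).card) * (sW b).card ^ 2 else 0) ≤ NM)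
    (n : ℕ) (S : (Fin (n + 1) → A × B) → Prop) [DecidablePred S] (hS : ∀ w, S w → ∃ i, mk (w i).2)
    (X : Finset ι) :
    |wlen Cl sC Wl sW (n + 1) S X| ≤
      ((n : ℝ) + 1) * vol cube Rs X * (Real.exp (-(κ * X.card)) * (NM * NC * (NC * NW) ^ n)) := by
  classical
  -- the letter weights and the charged summand G i w
  set F : (Fin (n + 1) → A × B) → ℝ := fun w => ∏ m, (‖Cl (w m).1‖ * ‖Wl (w m).2‖) with hF
  have hF0 : ∀ w, 0 ≤ F w := fun w => Finset.prod_nonneg fun m _ => mul_nonneg (norm_nonneg _) (norm_nonneg _)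
  set G : Fin (n + 1) → (Fin (n + 1) → A × B) → ℝ := fun i w =>
    if hull sC sW (n + 1) w = X ∧ mk (w i).2 ∧ (bprod (letter Cl Wl) (n + 1) w).trace ≠ 0
      then (vol cube Rs (sW (w i).2) : ℝ) * F w else 0 with hG
  have hG0 : ∀ i w, 0 ≤ G i w := fun i w => by
    simp only [hG]; exact ite_nonneg (mul_nonneg (Nat.cast_nonneg _) (hF0 w)) le_rfl
  -- Step 1–2: |wlen| ≤ Σ_w Σ_i G i w
  have h12 : |wlen Cl sC Wl sW (n + 1) S X| ≤ ∑ w : Fin (n + 1) → A × B, ∑ i, G i w := by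
    unfold wlen
    refine (Finset.abs_sum_le_sum_abs _ _).trans ?_
    rw [← Finset.sum_filter_add_sum_filter_not Finset.univ (fun w => hull sC sW (n + 1) w = X ∧ S w)
      (fun w => ∑ i, G i w)]
    refine le_trans (Finset.sum_le_sum fun w hw => ?_)
      (le_add_of_nonneg_right (Finset.sum_nonneg fun w _ => Finset.sum_nonneg fun i _ => hG0 i w))
    rw [Finset.mem_filter] at hw
    obtain ⟨i₀, hi₀⟩ := hS w hw.2.2
    by_cases htr : (bprod (letter Cl Wl) (n + 1) w).trace = 0
    · rw [htr, abs_zero]; exact Finset.sum_nonneg fun i _ => hG0 i w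
    · -- the per-word bound at the marked position i₀
      have hconf : ∀ z y, Wl (w i₀).2 z y ≠ 0 → z ∈ Rs.filter (fun z => cube z ∈ sW (w i₀).2) := fun z y hzy =>
        Finset.mem_filter.2 ⟨hmk _ hi₀ z y hzy, (hWs _ z y hzy).1⟩
      have hword := abs_trace_bprod_le_of_confined (Cl := Cl) (Wl := Wl) (Rs.filter fun z => cube z ∈ sW (w i₀).2)
        i₀.val n (Nat.le_of_lt_succ i₀.isLt) w hconf
      calc |(bprod (letter Cl Wl) (n + 1) w).trace| ≤ G i₀ w := by
            simp only [hG]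
            rw [if_pos ⟨hw.2.1, hi₀, htr⟩]
            exact hword
        _ ≤ ∑ i, G i w := Finset.single_le_sum (f := fun i => G i w) (fun i _ => hG0 i w) (Finset.mem_univ i₀)
  have hFrot : ∀ w : Fin (n + 1) → A × B, F (w ∘ finRotate (n + 1)) = F w := fun w => by
    simp only [hF]
    exact prod_comp_perm (fun p : A × B => ‖Cl p.1‖ * ‖Wl p.2‖) (n + 1) w (finRotate (n + 1))
  -- Step 3: every charged position sums to the same as position 0 (rotation)
  have hrot : ∀ (i : ℕ) (hi : i ≤ n), ∑ w : Fin (n + 1) → A × B, G ⟨i, Nat.lt_succ_of_le hi⟩ w =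
      ∑ w : Fin (n + 1) → A × B, G ⟨0, Nat.succ_pos n⟩ w := by
    intro i
    induction i with
    | zero => intro _; rfl
    | succ i ih =>
        intro hi
        have hi' : i < n := Nat.lt_of_succ_le hi
        rw [← ih (Nat.le_of_succ_le hi),
          ← sum_comp_perm_eq (n + 1) (finRotate (n + 1)) (G ⟨i, Nat.lt_succ_of_le (Nat.le_of_succ_le hi)⟩)]
        refine Finset.sum_congr rfl fun w _ => ?_
        simp only [hG]
        rw [hull_comp_perm, trace_bprod_comp_finRotate, comp_finRotate_apply_lt w hi', hFrot]
  -- Step 4: position 0 is the anchored sum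
  have h0 : ∑ w : Fin (n + 1) → A × B, G ⟨0, Nat.succ_pos n⟩ w ≤
      vol cube Rs X * (Real.exp (-(κ * X.card)) * (NM * NC * (NC * NW) ^ n)) := by
    refine le_trans (Finset.sum_le_sum fun w _ => ?_)
      (sum_anchored_le (sC := sC) (sW := sW) Rs mk (fun a => norm_nonneg (Cl a)) (fun b => norm_nonneg (Wl b)) hκ
        hNC0 hNW0 hNC hNW hNM n X)
    have hz : (⟨0, Nat.succ_pos n⟩ : Fin (n + 1)) = 0 := Fin.mk_zero
    simp only [hG, hz]
    by_cases hP : hull sC sW (n + 1) w = X ∧ mk (w 0).2 ∧ (bprod (letter Cl Wl) (n + 1) w).trace ≠ 0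
    · rw [if_pos hP, if_pos ⟨hP.1, hP.2.1, anchored_of_trace_ne_zero hCs hWs n w hP.2.2⟩, hF]
    · rw [if_neg hP]
      exact ite_nonneg (mul_nonneg (Nat.cast_nonneg _) (hF0 w)) le_rfl
  -- assembly
  calc |wlen Cl sC Wl sW (n + 1) S X| ≤ ∑ w : Fin (n + 1) → A × B, ∑ i, G i w := h12
    _ = ∑ i : Fin (n + 1), ∑ w : Fin (n + 1) → A × B, G i w := Finset.sum_comm
    _ = ∑ _i : Fin (n + 1), ∑ w : Fin (n + 1) → A × B, G ⟨0, Nat.succ_pos n⟩ w :=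
        Finset.sum_congr rfl fun i _ => hrot i.val (Nat.le_of_lt_succ i.isLt)
    _ ≤ ∑ _i : Fin (n + 1), vol cube Rs X * (Real.exp (-(κ * X.card)) * (NM * NC * (NC * NW) ^ n)) :=
        Finset.sum_le_sum fun i _ => h0
    _ = ((n : ℝ) + 1) * vol cube Rs X * (Real.exp (-(κ * X.card)) * (NM * NC * (NC * NW) ^ n)) := by
        rw [Finset.sum_const, Finset.card_univ, Fintype.card_fin, nsmul_eq_mul]
        push_cast
        ring

end Localized

/-! ## §6 The series over `l`: `W^{(j)″}(X)` and its printed shape -/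

section Series

variable {T ι A B : Type*} [Fintype T] [DecidableEq T] [Fintype ι] [DecidableEq ι]
  [Fintype A] [DecidableEq A] [Fintype B] [DecidableEq B]
variable {cube : T → ι} {Cl : A → Matrix T T ℝ} {sC : A → Finset ι} {Wl : B → Matrix T T ℝ} {sW : B → Finset ι}

omit [Fintype ι] [DecidableEq A] [DecidableEq B] in
/-- **`W″(X) = Σ_{l≥1} (1/2l)·wlen l S_l X` CONVERGES AND CARRIES ONE VOLUME FACTOR `|X ∩ R|`** — for selections forcing a marked
(confined) letter in every word and `N_C N_W < 1`: the length series (gen 8's `Wprime`, here with the W″-selection) is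
absolutely convergent and `|W″(X)| ≤ (N_M N_C/(2(1 − N_C N_W)))·|X ∩ R|·e^{−κ|X|}` (the factor `l` of `abs_wlen_le_localized`
cancels the `1/2l` of (5.7.4)). [cite: BalabanImbrieJaffe1988, (5.7.4) p.289, p.292] -/
theorem abs_Wprime_le_localized
    (hCs : ∀ a x y, Cl a x y ≠ 0 → cube x ∈ sC a ∧ cube y ∈ sC a)
    (hWs : ∀ b x y, Wl b x y ≠ 0 → cube x ∈ sW b ∧ cube y ∈ sW b)
    (Rs : Finset T) (mk : B → Prop) [DecidablePred mk] (hmk : ∀ b, mk b → ∀ z y, Wl b z y ≠ 0 → z ∈ Rs)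
    {κ : ℝ} (hκ : 0 ≤ κ) {NC NW NM : ℝ} (hNC0 : 0 ≤ NC) (hNW0 : 0 ≤ NW)
    (hNC : ∀ c : ι, ∑ a, (if c ∈ sC a then ‖Cl a‖ * Real.exp (κ * (sC a).card) * (sC a).card else 0) ≤ NC)
    (hNW : ∀ c : ι, ∑ b, (if c ∈ sW b then ‖Wl b‖ * Real.exp (κ * (sW b).card) * (sW b).card else 0) ≤ NW)
    (hNM : ∀ c : ι, ∑ b, (if mk b ∧ c ∈ sW b then ‖Wl b‖ * Real.exp (κ * (sW b).card) * (sW b).card ^ 2 else 0) ≤ NM)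
    (hρ : NC * NW < 1)
    (S : (l : ℕ) → (Fin (l + 1) → A × B) → Prop) [∀ l, DecidablePred (S l)] (hS : ∀ l w, S l w → ∃ i, mk (w i).2)
    (X : Finset ι) :
    Summable (fun l : ℕ => 1 / (2 * ((l : ℝ) + 1)) * wlen Cl sC Wl sW (l + 1) (S l) X) ∧
      |Wprime Cl sC Wl sW S X| ≤ NM * NC / (2 * (1 - NC * NW)) * (vol cube Rs X * Real.exp (-(κ * X.card))) := by
  set D : ℝ := vol cube Rs X * Real.exp (-(κ * X.card)) with hD
  have hD0 : 0 ≤ D := by positivity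
  set θ : ℝ := NC * NW with hθ
  have hθ0 : 0 ≤ θ := mul_nonneg hNC0 hNW0
  have h1θ : 0 < 1 - θ := by linarith
  -- termwise domination by a geometric sequence
  have hterm : ∀ l : ℕ, |1 / (2 * ((l : ℝ) + 1)) * wlen Cl sC Wl sW (l + 1) (S l) X| ≤ D * (NM * NC) / 2 * θ ^ l := by
    intro l
    have h := abs_wlen_le_localized hCs hWs Rs mk hmk hκ hNC0 hNW0 hNC hNW hNM l (S l) (hS l) X
    have hl : (0 : ℝ) < 2 * ((l : ℝ) + 1) := by positivity
    rw [abs_mul, abs_of_pos (one_div_pos.mpr hl)]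
    calc 1 / (2 * ((l : ℝ) + 1)) * |wlen Cl sC Wl sW (l + 1) (S l) X|
        ≤ 1 / (2 * ((l : ℝ) + 1)) * (((l : ℝ) + 1) * vol cube Rs X * (Real.exp (-(κ * X.card)) * (NM * NC * θ ^ l))) :=
          mul_le_mul_of_nonneg_left h (one_div_pos.mpr hl).le
      _ = D * (NM * NC) / 2 * θ ^ l := by
          simp only [hD]
          field_simp
  have hgeom : Summable (fun l : ℕ => D * (NM * NC) / 2 * θ ^ l) :=
    (summable_geometric_of_lt_one hθ0 hρ).mul_left _
  have hsum : Summable (fun l : ℕ => 1 / (2 * ((l : ℝ) + 1)) * wlen Cl sC Wl sW (l + 1) (S l) X) :=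
    Summable.of_norm_bounded hgeom (fun l => by rw [Real.norm_eq_abs]; exact hterm l)
  refine ⟨hsum, ?_⟩
  unfold Wprime
  calc |∑' l : ℕ, 1 / (2 * ((l : ℝ) + 1)) * wlen Cl sC Wl sW (l + 1) (S l) X|
      ≤ ∑' l : ℕ, |1 / (2 * ((l : ℝ) + 1)) * wlen Cl sC Wl sW (l + 1) (S l) X| := by
        have h := norm_tsum_le_tsum_norm hsum.norm
        simpa only [Real.norm_eq_abs] using h
    _ ≤ ∑' l : ℕ, D * (NM * NC) / 2 * θ ^ l := hsum.abs.tsum_le_tsum hterm hgeom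
    _ = D * (NM * NC) / 2 * (1 - θ)⁻¹ := by rw [tsum_mul_left, tsum_geometric_of_lt_one hθ0 hρ]
    _ = NM * NC / (2 * (1 - θ)) * D := by
        field_simp

/- r16's `PolymerSys` carries its polymer type in `Type`; the cube type of the printed form is accordingly `ι₀ : Type`. -/
variable {ι₀ : Type} [DecidableEq ι₀]
variable {cube₀ : T → ι₀} {sC₀ : A → Finset ι₀} {sW₀ : B → Finset ι₀}

omit [Fintype ι] [DecidableEq ι] [DecidableEq A] [DecidableEq B] in
/-- **THE PRINTED SHAPE OF THE `W^{(j)″}` BOUND** — *"|W^{(j)″}(X)| ≦ e_j^{1−α} e^{−cr(e_k)|X|} |X′ ∩ Λ₅^{(j)′} ∩ Λ₆^{(j+1)c}|"*: with decay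
rate `κ = c·r(e_k)` and under the constants hypothesis `N_M N_C/(2(1 − N_C N_W)) ≤ e_j^{1−α}` (the place of the print's
`e_j^{1−α}`: ONE marked kernel `w₅` per term, the `W`-pieces carrying it being *"small (O(e_j^{1−α}))"*, p. 287 — generic-constant
reading as in G-C2-p36-03), the constructed `W″` obeys, for every cube set `X`,
`|W″(X)| ≤ e_j^{1−α} · e^{−cr(e_k)|X|} · |X ∩ R|` — the (S2) shape of p36's knitting `BIJ88Ineq5714Proof.ineq5714_knit` on
the cube polymer system (`cubePolymers`, `|X|` = number of cubes), with `|X ∩ R|` the number of region sites in the cubes of `X`.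
[cite: BalabanImbrieJaffe1988, p.292] -/
theorem abs_Wprime_le_printed_localized
    (hCs : ∀ a x y, Cl a x y ≠ 0 → cube₀ x ∈ sC₀ a ∧ cube₀ y ∈ sC₀ a)
    (hWs : ∀ b x y, Wl b x y ≠ 0 → cube₀ x ∈ sW₀ b ∧ cube₀ y ∈ sW₀ b)
    (Rs : Finset T) (mk : B → Prop) [DecidablePred mk] (hmk : ∀ b, mk b → ∀ z y, Wl b z y ≠ 0 → z ∈ Rs)
    {c rk : ℝ} (hcrk : 0 ≤ c * rk) {NC NW NM : ℝ} (hNC0 : 0 ≤ NC) (hNW0 : 0 ≤ NW)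
    (hNC : ∀ cb : ι₀, ∑ a, (if cb ∈ sC₀ a then ‖Cl a‖ * Real.exp (c * rk * (sC₀ a).card) * (sC₀ a).card else 0) ≤ NC)
    (hNW : ∀ cb : ι₀, ∑ b, (if cb ∈ sW₀ b then ‖Wl b‖ * Real.exp (c * rk * (sW₀ b).card) * (sW₀ b).card else 0) ≤ NW)
    (hNM : ∀ cb : ι₀, ∑ b,
      (if mk b ∧ cb ∈ sW₀ b then ‖Wl b‖ * Real.exp (c * rk * (sW₀ b).card) * (sW₀ b).card ^ 2 else 0) ≤ NM)
    (hρ : NC * NW < 1)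
    (S : (l : ℕ) → (Fin (l + 1) → A × B) → Prop) [∀ l, DecidablePred (S l)] (hS : ∀ l w, S l w → ∃ i, mk (w i).2)
    {ej α : ℝ} (hconst : NM * NC / (2 * (1 - NC * NW)) ≤ ej ^ (1 - α)) (X : Finset ι₀) :
    |Wprime Cl sC₀ Wl sW₀ S X| ≤
      ej ^ (1 - α) * Real.exp (-(c * rk) * (cubePolymers ι₀).card X) * (vol cube₀ Rs X : ℝ) := by
  have h := (abs_Wprime_le_localized hCs hWs Rs mk hmk hcrk hNC0 hNW0 hNC hNW hNM hρ S hS X).2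
  have hrest : 0 ≤ (vol cube₀ Rs X : ℝ) * Real.exp (-(c * rk * X.card)) := by positivity
  calc |Wprime Cl sC₀ Wl sW₀ S X| ≤ NM * NC / (2 * (1 - NC * NW)) * (vol cube₀ Rs X * Real.exp (-(c * rk * X.card))) := h
    _ ≤ ej ^ (1 - α) * (vol cube₀ Rs X * Real.exp (-(c * rk * X.card))) := mul_le_mul_of_nonneg_right hconst hrest
    _ = ej ^ (1 - α) * Real.exp (-(c * rk) * (cubePolymers ι₀).card X) * (vol cube₀ Rs X : ℝ) := by
        simp only [cubePolymers, neg_mul]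
        ring

end Series

end Literature.MathematicalPhysics.QuantumFieldTheory.BalabanImbrieJaffe1984to88.BIJ88W2Localized292
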